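import Literature.MathematicalPhysics.QuantumFieldTheory.Balaban1983to89.B9Eq3126QG1QInvPointDecayTowerDiagonalClosed
import Literature.MathematicalPhysics.QuantumFieldTheory.Balaban1983to89.B9Eq347LocalFromBlockDecay
import Literature.MathematicalPhysics.QuantumFieldTheory.Balaban1983to89.Beta.RemainderHasMajGreenPrime

/-!
# T. Bałaban, *Propagators for lattice gauge theories in a background field*, Commun. Math. Phys. **99** (1985) 389–434
# [Balaban1985BackgroundPropagators] (3.126) p. 420, (3.129) p. 421, (3.132) p. 422 with [Balaban1985Variational] (45) p. 285, (110) p. 294, (129) p. 297, (190) p. 308: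
# **THE COARSE-BOND POINT DECAY OF `(Q_kG₁,k(U)Q_k†)⁻¹` ON THE TOWER (ne9-leaf-03's (FCLK), `∃ (α₀, r₁, A)` BEFORE THE HEIGHT) AS THE `hInv₀`-SHAPED
# `B11SectG.HasMaj` OF ROW (D4) BETWEEN THE SUP SIZES OF (190) — HEIGHT-FREE, PRICE `√d`, NO LETTER BEYOND PRINT's WINDOW**

CITATION HEADER (lean-in-tree rule 2026-08-18).  Sources: [Balaban1985BackgroundPropagators] (B9; held `paper:balaban1985-cmp99-background-propagators`,
journal page = PDF page + 388): (3.126) p. 420 and (3.129) p. 421 *«H₁B = G₁Q*(QG₁Q*)⁻¹B»* (the operators of the second averaging step), p. 422 *«The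
operators (QGQ*)⁻¹, or (QG₁Q*)⁻¹, can be analyzed in the same way as the operator (Q′G′²Q′*)⁻¹. We will not repeat these considerations here, let us write only
bounds. We have … (3.132)»* (the kernel bound this row is the operator SHADOW of — pp. 420–422 re-read this generation in the held text layer), Thm 3.11 p. 416,
(3.49) p. 399 (blocks), (3.11) p. 392 (weighted `L²` scalar products), (3.35)–(3.37) p. 396 (the small-field class) — the latter loci as read by gens 104–109 of
this lineage and printed in (FCLK)'s header; [Balaban1985Variational] (B11; `paper:balaban1985-cmp102-variational-
background`, journal page = PDF page + 276): (45) p. 285 and (110) p. 294 (`(QG₁Q*)⁻¹` exists and decays), (129) p. 297 *«H₀ = GQ*(QGQ*)⁻¹ … satisfies the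
bound (3.133) [5]»*, (180) p. 306, (182) p. 307, (190) p. 308 (as read by gens 100–107 of this lineage, memo `FLAT-LETTERS-LOCATED.md` §§13–17);
[Balaban1984PropagatorsII] (B6) (2.51)–(2.52) p. 232, (2.54) p. 233.

WHY THIS FILE (audit cell `pub-balaban`, BINDER row (D4), OWNER lineage `b2b-balaban-beta-an4`, gen 110; plan «Y4a», journal [AN4-G110-INTENT-1]).
NODE D of row (D4) at the origin in a background is the END `Beta.RemainderOriginTwoLetters.ineq190_origin_of_two_letters` (V79): [15] (190) for
`(1 + G̃Δ⁽²⁾)H₀`, `H₀ = G₀Q*(QG₀Q*)⁻¹J`, from TWO analytic letters — `hG0 : HasMaj b3 bN G₀ (B·e^{−δ₁d})` (the sup row of the BOND Green's function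
`G₀ = Δ_a⁻¹`, [5] Thm 3.3) and `hInv₀ : HasMaj bQ bQ′ Inv₀ (B_I·e^{−δ_Id})` (the row of `(QG₀Q*)⁻¹`, [5] (3.132)) — plus structure.  On the NE9 cell's
TOWER (`B9Eq326OperatorTower`: heights `n`, spacing `ηL^{n+1} = 1`, the bond operator `Δ_{a,k}(U) = laplaceAk`, `G₁,k = Δ_{a,k}⁻¹`, the averaging `Q_k(U) =
QkW`, `(Q_kG₁,kQ_k†)⁻¹ = B11Eq103H1Complex.KinvLatticeK`) ne9-leaf-03's road ΔA-CT closes the `L²` point decay of `(Q_kG₁,kQ_k†)⁻¹` on print's diagonal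
with ONE `(α₀, r₁, A)` BEFORE the height, the spacing, the weights, the period and the background:
`B9Eq3126QG1QInvPointDecayTowerDiagonalClosed.exists_bondPoint_decay_Kinv_diagonal_closed` ((FCLK): `‖r_{y₁} ∘ (Q_kG₁,kQ_k†)⁻¹ ∘ r_{y₀}‖_{L²(c₁)} ≤
A·e^{−r₁·d_m(y₀,y₁)}`, `r_y` = restriction to the `d` coarse bonds at `y`).  The (D4) socket's currency is sup → sup (the (4.4) ball of [I] is a sup-norm
ball, `Data190.hdom`); on the FINE lattice an `L²` block row read pointwise costs `√(d·L^{(n+1)d})` at height `n` (`B9Eq326LocalPartPointRow`, HONEST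
SCOPE) — but on the COARSE bond lattice a block IS the `d` bonds at a site, the weight `c₁` cancels between the block mass `d·c₁` and the output weight,
and (FCLK) IS a sup → sup row with constant `√d·A`, height-free.  THIS FILE records exactly that:
* §1 **`hasMaj_bond_sup_of_pointDecay`** ∕ **`hasMaj_bond_of_pointDecay`** ([folklore], operator-generic): for ANY `ℂ`-linear `T` on the coarse bond space
  `BondL2K ℂ d m c₁ W` with `‖r_{y₁} ∘ T ∘ r_{y₀}‖ ≤ A·e^{−r·d_m(y₀,y₁)}`: `HasMaj S_m S_m ((e ∘ T ∘ e⁻¹)↾ℝ) (√d·A·e^{−r·d_∞})` in the sup sizes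
  `B11SupSize190.supSize` over the torus of blocks (`B9Eq347LocalFromBlockDecay.local_of_block_decay` at `μ = d·c₁`, `ω = c₁` +
  `Beta.RemainderHasMajGreenPrime.hasMaj_supSize_of_local` at `X := Bond d m`), and the same with the kernel `√d·A·e^{−(r∕d)·dist}` of the geometry
  `toB6 (torusGeom m η₀ L₀ M₀) R H` (`d₁ ≤ d·d_∞`), operator packaged as in V79's binder — usable verbatim for the other coarse-lattice letters of the
  NE9 OWNER's plan v11 (`S⁻¹`, `(Q′G′²Q′*)⁻¹`);
* §2 **`exists_hasMaj_Kinv_tower_sup`** ∕ **`exists_hasMaj_Kinv_tower`** — (FCLK) BY NAME in §1: `∃ (α₀, r₁, A′)`, `A′ = √d·A`, `0 < α₀`, `0 < r₁`, `0 ≤ A′`,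
  BEFORE `∀ n η c₀ c₁ m U …`, such that at every height of the tower, for every background of print's class ((3.35)–(3.36) read on the torus: `U(b) ∈ U1`,
  `star U(b) = U(b)⁻¹`, `‖U(b) − 1‖ ≤ αη`, `‖U(∂p) − 1‖ ≤ αη²`, level averages `‖Ū^j(b) − 1‖ ≤ ε_j ≤ αϱ^j` in `U1`, `α ≤ α₀`, with the E162 cube data
  `(αU, hα1, hαL, hU1, hreg)` the tower operators are typed with), ANY positivity witness `hpos` of `Δ_{a,k}(U)` and ANY surjectivity witness `hQ` of `Q_k(U)`,
  and every torus geometry: `HasMaj S_m^{bond} S_m^{bond} ((e ∘ (Q_kG₁,kQ_k†)⁻¹ ∘ e⁻¹)↾ℝ) (A′·e^{−r₁·d_∞})` (resp. `A′·e^{−(r₁∕d)·dist}`) — the socket's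
  `hInv₀` letter for NE9's tower is a TREE THEOREM BY NAME, with no displayed analytic letter.
AFTER THIS FILE the (D4) socket at the origin on NE9's tower (V79 ∕ X2a `RemainderDecay190TwoGridOrigin`'s `hG0`, `hInv₀`, `hH0`) wants ONE analytic
letter: the height-free sup row of the bond Green's function `G₁,k` ([5] Thm 3.3 (3.42) first entry; NE9 plan v11 storey G₁ = the decayed tower local part
+ storey J at the tower + the letter algebra — ne9-leaf-03 g78 [NE9LEAF03-G78-W1] (c)); `hH0` then follows from `H₁,k = G₁,kQ_k†(Q_kG₁,kQ_k†)⁻¹` ((129))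
with the sup-preserving extension `Q_k†` and this file.

HONEST SCOPE.  [folklore] change of currency on the coarse lattice + (FCLK) BY NAME; NO estimate of [5] or [15] is proved here; the constants are the
road's (crude: `A = (2∕μ₁)e^{r₀}` of (FCLK), Combes–Thomas rate `r₁`, not print's `δ₀`); operator row between sup sizes with SHARP blocks (κ = 1), not
print's kernel bound (3.132) with its `(L^jη)^{−2}(L^{j′}η)^{−d}` weights; the E162 cube data and the `hpos`∕`hQ` witnesses stay binders exactly as (FCLK)
displays them (their derivation from the two windows on the unitary class is `Beta.RemainderHasMajGreenPrimeTowerDecayCoshPlaquette`'s business, not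
repeated here).  NE9's tower = [15]'s case `Ω_k = T_η`; the multi-level `{Ω_j}` case and the identification of Bałaban's step-`k` objects with these
operators are NODE O (FROZEN (0)).  Row (D4) class UNCHANGED (instance 0∕1; critical-path width 0 = NODE O; D4 DISCHARGE NO DATE); NOT B12 Thm 2, NOT
BetaPertH, NOT continuum, NOT Clay.  HONEST DEPENDENCY (cell line): continuum YM on T⁴ ⇐ BetaPertH ∧ nine spine estimates (0/9 proved); BetaPertH ⇐ (D1) ∧
(D4) ∧ CAP+tail; G-an2-4 gates asym, D1 and NE2/3/4.  NEW file importing (FCLK) + `B9Eq347LocalFromBlockDecay` + `Beta.RemainderHasMajGreenPrime`; nothing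
modified; 0 `def`; standard axioms; no `sorry`.  Net new unproved facts: 0.
-/

noncomputable section

open scoped BigOperators InnerProductSpace ComplexConjugate

namespace Literature.MathematicalPhysics.QuantumFieldTheory.Balaban1983to89.Beta.RemainderHasMajQG1QInvTowerClosed

open B11SectG B11SupSize190
open B4Sect5Torus (TSite tdist ccoord tdist_nonneg tdist_symm)
open B5TorusCover (UT)
open B9Thm34Ext (toB6)
open B9Thm37GlueTorus (torusGeom tdist1)
open B9SectCLatticeCarrier (Bond bpos)
open B9Eq311L2Pairing (WL2)
open B9Eq315QTower (towerP UlevOf)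
open B9Eq315QTorus (perCfg cornerSite)
open B7Prop1Explicit (U1 Wcx boxVec)
open B9Eq310DeltaPrime (plaqHolU)
open B11Eq103H1Complex (BondL2K KinvLatticeK)
open B9Eq326OperatorTower (laplaceAk QkW)
open B9Eq3126QG1QInvPointDecayTowerDiagonalClosed (exists_bondPoint_decay_Kinv_diagonal_closed)
open B9Eq347LocalFromBlockDecay (local_of_block_decay)
open B9Eq349BlockMultipliers (exists_block_clm_family)
open Beta.RemainderHasMajGreenPrime (hasMaj_supSize_of_local)

/-! ### Torus bookkeeping on the COARSE bond lattice (block = the `d` bonds at a site; private) -/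

section Aux

variable {d : ℕ} {m : Fin d → ℕ}

/-- `ofSite a = y ↔ a = toSite y`. [folklore] -/
private theorem ofSite_eq_iff (a : TSite d m) (y : UT m) : UT.ofSite m a = y ↔ a = UT.toSite m y := by
  constructor
  · rintro rfl; rfl
  · rintro rfl; rfl

/-- The boxes of the bond-position map are its fibres. [folklore] -/
private theorem mem_boxBond_iff (y : UT m) (b : Bond d m) :
    b ∈ (Finset.univ.filter fun b : Bond d m => bpos b = UT.toSite m y) ↔ UT.ofSite m (bpos b) = y := by
  rw [Finset.mem_filter, ofSite_eq_iff]
  simp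

variable [∀ i, NeZero (m i)]

/-- `d₁ ≤ d·d_∞` on the torus of blocks. [folklore] -/
private theorem tdist1_le_mul_tdist (y v : UT m) :
    tdist1 m y v ≤ d * tdist m (UT.toSite m y) (UT.toSite m v) := by
  unfold tdist1 tdist
  have h : ∀ i ∈ (Finset.univ : Finset (Fin d)),
      ((ccoord m (UT.toSite m y) (UT.toSite m v) i : ℕ) : ℝ) ≤
        ((Finset.univ.sup (ccoord m (UT.toSite m y) (UT.toSite m v)) : ℕ) : ℝ) :=
    fun i hi => by exact_mod_cast Finset.le_sup (f := ccoord m (UT.toSite m y) (UT.toSite m v)) hi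
  calc ∑ i, ((ccoord m (UT.toSite m y) (UT.toSite m v) i : ℕ) : ℝ)
      ≤ ∑ _i : Fin d, ((Finset.univ.sup (ccoord m (UT.toSite m y) (UT.toSite m v)) : ℕ) : ℝ) :=
        Finset.sum_le_sum h
    _ = d * ((Finset.univ.sup (ccoord m (UT.toSite m y) (UT.toSite m v)) : ℕ) : ℝ) := by
        rw [Finset.sum_const, Finset.card_univ, Fintype.card_fin, nsmul_eq_mul]

/-- `e^{−r·d_∞} ≤ e^{−(r/d)·d₁}` for `r ≥ 0`. [folklore] -/
private theorem exp_tdist_le_exp_tdist1 {r : ℝ} (hr : 0 ≤ r) (y v : UT m) :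
    Real.exp (-(r * tdist m (UT.toSite m y) (UT.toSite m v))) ≤ Real.exp (-(r / d * tdist1 m y v)) := by
  refine Real.exp_le_exp.mpr (neg_le_neg ?_)
  have h1 := tdist1_le_mul_tdist y v
  have ht : 0 ≤ tdist m (UT.toSite m y) (UT.toSite m v) := tdist_nonneg _ _ _
  rcases Nat.eq_zero_or_pos d with hd | hd
  · subst hd
    simp only [Nat.cast_zero, div_zero, zero_mul]
    exact mul_nonneg hr ht
  · have hd' : (0 : ℝ) < d := by exact_mod_cast hd
    calc r / d * tdist1 m y v ≤ r / d * (d * tdist m (UT.toSite m y) (UT.toSite m v)) :=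
          mul_le_mul_of_nonneg_left h1 (div_nonneg hr hd'.le)
      _ = r * tdist m (UT.toSite m y) (UT.toSite m v) := by
          field_simp

end Aux

/-! ## §1  On the coarse bond lattice a point-decay row in `L²(c₁)` IS a block majorant between the sup sizes of (190) — price `√d`, no height -/

section Generic

variable {d : ℕ} (m : Fin d → ℕ) [∀ i, NeZero (m i)]
  {W : Type} [NormedAddCommGroup W] [InnerProductSpace ℂ W] [FiniteDimensional ℂ W] {c₁ : ℝ} [Fact (0 < c₁)]
  (T : BondL2K ℂ d m c₁ W →ₗ[ℂ] BondL2K ℂ d m c₁ W) (η₀ L₀ M₀ R : ℝ) (H : Prop)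

/-- **A POINT-DECAY ROW ON THE COARSE BOND LATTICE IS A BLOCK MAJORANT FOR THE SUP SIZES — NO HEIGHT, PRICE `√d`.**  On the unit lattice
of coarse bonds `Bond d m` (weight `c₁` on every bond) a «block» is the set of the `d` bonds based at one site, so an operator bound on the point
family `‖r_{y₁} ∘ T ∘ r_{y₀}‖_{L²(c₁)} ≤ A·e^{−r·d_m(y₀,y₁)}` (`r_y` = restriction to the bonds at `y`; `A, r ≥ 0`) gives, for `g` supported on the
bonds at `v` with `‖g(c)‖ ≤ G`: `‖(Tg)(b)‖ ≤ √d·A·e^{−r·d_m(b₋, v)}·G` (the weight `c₁` CANCELS between the block mass `d·c₁` and the output weight: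
`B9Eq347LocalFromBlockDecay.local_of_block_decay` at `μ = d·c₁`, `ω = c₁`), i.e. `HasMaj S_m S_m ((e ∘ T ∘ e⁻¹)↾ℝ) (√d·A·e^{−r·d_∞})` in the sup
sizes of (190) over the torus of blocks (`Beta.RemainderHasMajGreenPrime.hasMaj_supSize_of_local` at `X := Bond d m`, boxes = fibres of `bpos`).
Contrast: on the FINE lattice the same reading costs `√(d·L^{(n+1)d})` at height `n` (`B9Eq326LocalPartPointRow` HONEST SCOPE). [folklore]
[cite: Balaban1985BackgroundPropagators, (3.49) p.399, (3.11) p.392] [cite: Balaban1984PropagatorsII, (2.51)–(2.52) p.232] [cite: Balaban1985Variational, (190) p.308] -/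
theorem hasMaj_bond_sup_of_pointDecay (hd : 1 ≤ d)
    {rF : TSite d m → BondL2K ℂ d m c₁ W →L[ℂ] BondL2K ℂ d m c₁ W}
    (hrF : ∀ (y : TSite d m) (g : BondL2K ℂ d m c₁ W) (c : Bond d m),
      WL2.equiv ℂ (fun _ : Bond d m => c₁) W (rF y g) c = if bpos c = y then WL2.equiv ℂ (fun _ : Bond d m => c₁) W g c else 0)
    {A r : ℝ} (hA : 0 ≤ A)
    (hdec : ∀ y₀ y₁ : TSite d m, ‖rF y₁ ∘L LinearMap.toContinuousLinearMap T ∘L rF y₀‖ ≤ A * Real.exp (-(r * tdist m y₀ y₁))) :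
    HasMaj
      (supSize (toB6 (torusGeom m η₀ L₀ M₀) R H)
        (fun y => Finset.univ.filter fun b : Bond d m => bpos b = UT.toSite m y)
        (fun b => UT.ofSite m (bpos b)) : BlockNorm (toB6 (torusGeom m η₀ L₀ M₀) R H) (Bond d m → W))
      (supSize (toB6 (torusGeom m η₀ L₀ M₀) R H)
        (fun y => Finset.univ.filter fun b : Bond d m => bpos b = UT.toSite m y)
        (fun b => UT.ofSite m (bpos b)))
      (((WL2.linearEquiv ℂ ℂ (fun _ : Bond d m => c₁) : BondL2K ℂ d m c₁ W ≃ₗ[ℂ] (Bond d m → W)).toLinearMap ∘ₗ T ∘ₗ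
          (WL2.linearEquiv ℂ ℂ (fun _ : Bond d m => c₁) : BondL2K ℂ d m c₁ W ≃ₗ[ℂ] (Bond d m → W)).symm.toLinearMap).restrictScalars ℝ)
      (fun y v => (Real.sqrt d * A) * Real.exp (-(r * tdist m (UT.toSite m y) (UT.toSite m v)))) := by
  classical
  have hc₁ : 0 < c₁ := Fact.out
  have hm : ∀ i, 1 ≤ m i := fun i => Nat.one_le_iff_ne_zero.mpr (NeZero.ne (m i))
  haveI : Nonempty (Bond d m) := ⟨(fun _ => 0, ⟨0, hd⟩)⟩
  refine hasMaj_supSize_of_local (fun y b => mem_boxBond_iff y b) _ (fun y v => by positivity) ?_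
  intro v g G hgv hgG b
  -- the carrier element `e⁻¹ g`, whose values are those of `g`
  set g' : BondL2K ℂ d m c₁ W :=
    (WL2.linearEquiv ℂ ℂ (fun _ : Bond d m => c₁) : BondL2K ℂ d m c₁ W ≃ₗ[ℂ] (Bond d m → W)).symm g with hg'
  have hgv' : ∀ c, bpos c ≠ UT.toSite m v → WL2.equiv ℂ (fun _ : Bond d m => c₁) W g' c = 0 := by
    intro c hc
    have hne : UT.ofSite m (bpos c) ≠ v := fun h => hc ((ofSite_eq_iff _ _).1 h)
    exact hgv c hne
  have hgG' : ∀ c, ‖WL2.equiv ℂ (fun _ : Bond d m => c₁) W g' c‖ ≤ G := fun c => hgG c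
  -- the block mass `d·c₁` of the bonds at one site
  have hμ : ∀ u : TSite d m, ∑ c : Bond d m, (if bpos c = u then c₁ else 0) ≤ d * c₁ := by
    intro u
    have hsite : ∑ x : TSite d m, (if x = u then c₁ else 0) = c₁ := by rw [Finset.sum_ite_eq' Finset.univ u]; simp
    calc ∑ c : Bond d m, (if bpos c = u then c₁ else 0)
        = ∑ x : TSite d m, ∑ _k : Fin d, (if x = u then c₁ else 0) := by rw [Fintype.sum_prod_type]
      _ = ∑ x : TSite d m, (d : ℝ) * (if x = u then c₁ else 0) := by
          refine Finset.sum_congr rfl fun x _ => ?_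
          rw [Finset.sum_const, Finset.card_univ, Fintype.card_fin, nsmul_eq_mul]
      _ = (d : ℝ) * c₁ := by rw [← Finset.mul_sum, hsite]
      _ ≤ d * c₁ := le_rfl
  -- (K): the `L²(c₁)` point decay read pointwise; the weight cancels
  have h := local_of_block_decay (π := fun c : Bond d m => bpos c) (π' := fun c : Bond d m => bpos c) hrF hrF
    (LinearMap.toContinuousLinearMap T) (fun u u' => tdist m u' u) hA hc₁ (fun _ => le_rfl) hμ
    (fun u u' => hdec u' u) (UT.toSite m v) g' G hgv' hgG' b
  have hsq : A * Real.sqrt (d * c₁) / Real.sqrt c₁ = Real.sqrt d * A := by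
    have hs : Real.sqrt c₁ ≠ 0 := (Real.sqrt_pos.2 hc₁).ne'
    rw [Real.sqrt_mul (Nat.cast_nonneg d), mul_div_assoc, mul_div_cancel_right₀ _ hs, mul_comm]
  rw [hsq, tdist_symm hm] at h
  exact le_of_eq_of_le rfl (h.trans_eq (by simp only [UT.toSite_ofSite]))

/-- **THE SAME IN THE GEOMETRY's OWN DISTANCE, OPERATOR AS A CONTINUOUS LINEAR MAP** (`δ = r∕d`, `d₁ ≤ d·d_∞`): token for token the `hInv₀` binder
shape `HasMaj bQ bQ′ Inv₀ (B_I·e^{−δ_I·dist})` of `Beta.RemainderOriginTwoLetters.ineq190_origin_of_two_letters` with `bQ = bQ′ =` the sup size over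
the coarse bonds. [folklore] [cite: Balaban1984PropagatorsII, (2.51)–(2.52) p.232, (2.54) p.233] [cite: Balaban1985Variational, (190) p.308] -/
theorem hasMaj_bond_of_pointDecay (hd : 1 ≤ d)
    {rF : TSite d m → BondL2K ℂ d m c₁ W →L[ℂ] BondL2K ℂ d m c₁ W}
    (hrF : ∀ (y : TSite d m) (g : BondL2K ℂ d m c₁ W) (c : Bond d m),
      WL2.equiv ℂ (fun _ : Bond d m => c₁) W (rF y g) c = if bpos c = y then WL2.equiv ℂ (fun _ : Bond d m => c₁) W g c else 0)
    {A r : ℝ} (hA : 0 ≤ A) (hr : 0 ≤ r)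
    (hdec : ∀ y₀ y₁ : TSite d m, ‖rF y₁ ∘L LinearMap.toContinuousLinearMap T ∘L rF y₀‖ ≤ A * Real.exp (-(r * tdist m y₀ y₁))) :
    HasMaj
      (supSize (toB6 (torusGeom m η₀ L₀ M₀) R H)
        (fun y => Finset.univ.filter fun b : Bond d m => bpos b = UT.toSite m y)
        (fun b => UT.ofSite m (bpos b)) : BlockNorm (toB6 (torusGeom m η₀ L₀ M₀) R H) (Bond d m → W))
      (supSize (toB6 (torusGeom m η₀ L₀ M₀) R H)
        (fun y => Finset.univ.filter fun b : Bond d m => bpos b = UT.toSite m y)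
        (fun b => UT.ofSite m (bpos b)))
      (((LinearMap.toContinuousLinearMap
          ((WL2.linearEquiv ℂ ℂ (fun _ : Bond d m => c₁) : BondL2K ℂ d m c₁ W ≃ₗ[ℂ] (Bond d m → W)).toLinearMap ∘ₗ T ∘ₗ
            (WL2.linearEquiv ℂ ℂ (fun _ : Bond d m => c₁) : BondL2K ℂ d m c₁ W ≃ₗ[ℂ] (Bond d m → W)).symm.toLinearMap)).restrictScalars ℝ :
          (Bond d m → W) →ₗ[ℝ] (Bond d m → W)))
      (fun y v => (Real.sqrt d * A) * Real.exp (-(r / d * (toB6 (torusGeom m η₀ L₀ M₀) R H).dist y v))) := by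
  have h := hasMaj_bond_sup_of_pointDecay m T η₀ L₀ M₀ R H hd hrF hA hdec
  exact (h.mono fun y v => mul_le_mul_of_nonneg_left (exp_tdist_le_exp_tdist1 hr y v) (by positivity)).congr fun μ => rfl

end Generic

/-! ## §2  (FCLK) BY NAME: the socket's `hInv₀` letter for NE9's tower, `∃ (α₀, r₁, A′)` before the height, the volume and the background -/

section Tower

variable {d : ℕ} (hd : 1 ≤ d) (L : ℕ) [NeZero L] (hL : 1 ≤ L) (hL3 : 3 ≤ L)
  {𝔸 : Type*} [NormedRing 𝔸] [NormedAlgebra ℂ 𝔸] [CompleteSpace 𝔸] [NormOneClass 𝔸] [StarRing 𝔸] [NormedStarGroup 𝔸] [StarModule ℂ 𝔸]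
  {W : Type} [NormedAddCommGroup W] [InnerProductSpace ℂ W] [FiniteDimensional ℂ W] (φ : W ≃ₗ[ℂ] 𝔸)
  {Mφ Mφ' : ℝ} (hMφ : 0 ≤ Mφ) (hMφ' : 0 ≤ Mφ') (hφ : ∀ w, ‖φ w‖ ≤ Mφ * ‖w‖) (hφ' : ∀ X, ‖φ.symm X‖ ≤ Mφ' * ‖X‖) (hstar : ∀ X : 𝔸, ‖star X‖ ≤ ‖X‖)
  {a : ℝ} (ha : 0 < a) {a' : ℝ} (ha' : 0 < a') {ϱ : ℝ} (hϱ0 : 0 ≤ ϱ) (hϱ1 : ϱ < 1)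
  (τ : 𝔸 →ₗ[ℂ] ℂ) {Cτ : ℝ} (hτ : ∀ X, ‖τ X‖ ≤ Cτ * ‖X‖) (hCτ : 0 ≤ Cτ) {Mτ : ℝ} (hτm : ∀ X Y : 𝔸, ‖τ (X * Y)‖ ≤ Mτ * ‖X‖ * ‖Y‖) (hMτ : 0 ≤ Mτ)
  {ρw : ℝ} (hρw : 0 ≤ ρw)
  (hτ₁ : ∀ X : 𝔸, τ (star X) = conj (τ X)) (hτ₂ : ∀ X Y : 𝔸, τ (X * Y) = τ (Y * X)) (hφτ : ∀ X Y : 𝔸, ⟪φ.symm X, φ.symm Y⟫_ℂ = τ (star X * Y))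

include hd hL hL3 hMφ hMφ' hφ hφ' hstar ha ha' hϱ0 hϱ1 hτ hCτ hτm hMτ hρw hτ₁ hτ₂ hφτ in
/-- **THE `hInv₀` LETTER OF NODE D ON NE9's TOWER, HEIGHT-FREE — (FCLK) AS `HasMaj S_m^{bond} S_m^{bond} ((e ∘ (Q_kG₁,kQ_k†)⁻¹ ∘ e⁻¹)↾ℝ) (A′·e^{−r₁·d_∞})`,
`∃ (α₀, r₁, A′)` BEFORE THE HEIGHT.**  Binders = (FCLK)'s, token for token, minus its restriction family `r_y` (inhabited inside by
`B9Eq349BlockMultipliers.exists_block_clm_family`), plus an arbitrary torus geometry `(η₀, L₀, M₀, R, H)`; `A′ = √d·A`.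
[cite: Balaban1985BackgroundPropagators, (3.126) p.420, (3.129) p.421, (3.132) p.422, Thm 3.11 p.416, (3.49) p.399, (3.35)–(3.37) p.396]
[cite: Balaban1985Variational, (45) p.285, (110) p.294, (129) p.297, (190) p.308] [cite: Balaban1984PropagatorsII, (2.51)–(2.52) p.232] -/
theorem exists_hasMaj_Kinv_tower_sup :
    ∃ α₀ r₁ A' : ℝ, 0 < α₀ ∧ 0 < r₁ ∧ 0 ≤ A' ∧
      ∀ (n : ℕ) (η : ℝ) (_hηL : η * (L : ℝ) ^ (n + 1) = 1) (c₀ c₁ : ℝ) [Fact (0 < c₀)] [Fact (0 < c₁)]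
        (_hw : c₀ * ((L : ℝ) ^ (n + 1)) ^ d = c₁) (_hρ : |η| ^ d / c₀ ≤ ρw) (m : Fin d → ℕ) [∀ i, NeZero (m i)] (_hm : ∀ i, 1 ≤ m i)
        (U : Bond d (towerP L m (n + 1)) → 𝔸ˣ) (αU : ℕ → ℝ) (_hα0 : ∀ j, 0 ≤ αU j) (hα1 : ∀ j, αU j ≤ 1 / 64)
        (hαL : ∀ j, 50 * (d + 1) * αU j * (L : ℝ) ^ d ≤ 1 / 2)
        (hU1 : ∀ (j : ℕ) (x : B7Prop1Explicit.Site d) (k : Fin d), perCfg (towerP L m (j + 1)) (UlevOf L m (n + 1) U j) x k ∈ U1 𝔸)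
        (hreg : ∀ (j : ℕ) (y : TSite d (towerP L m j)) (k : Fin d) (ρ' : Fin d → Fin L),
          ‖((Wcx L (perCfg (towerP L m (j + 1)) (UlevOf L m (n + 1) U j)) (cornerSite L y) k (boxVec L ρ') : 𝔸ˣ) : 𝔸) - 1‖ ≤ αU j)
        (εU : ℕ → ℝ) (_hεU : ∀ j, 0 ≤ εU j) (_hUε : ∀ (j : ℕ) (b : Bond d (towerP L m (j + 1))), ‖(UlevOf L m (n + 1) U j b : 𝔸) - 1‖ ≤ εU j)
        (_hLb : ∀ (j : ℕ) (b : Bond d (towerP L m (j + 1))), UlevOf L m (n + 1) U j b ∈ U1 𝔸)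
        (α : ℝ) (_hα : 0 ≤ α) (_hαle : α ≤ α₀)
        (_hUst : ∀ b, star (U b : 𝔸) = (((U b)⁻¹ : 𝔸ˣ) : 𝔸)) (_hUb : ∀ b, U b ∈ U1 𝔸) (_hUη : ∀ b, ‖(U b : 𝔸) - 1‖ ≤ α * η)
        (_hpl : ∀ p : B9SectCLatticeCarrier.Plaq d (towerP L m (n + 1)), ‖(plaqHolU U p : 𝔸) - 1‖ ≤ α * η ^ 2)
        (_hεg : ∀ j < n + 1, εU j ≤ α * ϱ ^ j)
        (hpos : ∀ x : BondL2K ℂ d (towerP L m (n + 1)) c₀ W, x ≠ 0 →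
          0 < RCLike.re ⟪x, laplaceAk L m n φ η U hL αU hα1 hU1 hreg τ (c₀ := c₀) (c₁ := c₁) a x⟫_ℂ)
        (hQ : Function.Surjective (QkW L m n φ U hL αU hα1 hU1 hreg (c₀ := c₀) (c₁ := c₁)))
        (η₀ L₀ M₀ R : ℝ) (H : Prop),
        HasMaj
          (supSize (toB6 (torusGeom m η₀ L₀ M₀) R H)
            (fun y => Finset.univ.filter fun b : Bond d m => bpos b = UT.toSite m y)
            (fun b => UT.ofSite m (bpos b)) : BlockNorm (toB6 (torusGeom m η₀ L₀ M₀) R H) (Bond d m → W))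
          (supSize (toB6 (torusGeom m η₀ L₀ M₀) R H)
            (fun y => Finset.univ.filter fun b : Bond d m => bpos b = UT.toSite m y)
            (fun b => UT.ofSite m (bpos b)))
          (((WL2.linearEquiv ℂ ℂ (fun _ : Bond d m => c₁) : BondL2K ℂ d m c₁ W ≃ₗ[ℂ] (Bond d m → W)).toLinearMap ∘ₗ
              KinvLatticeK hpos hQ ∘ₗ
              (WL2.linearEquiv ℂ ℂ (fun _ : Bond d m => c₁) : BondL2K ℂ d m c₁ W ≃ₗ[ℂ] (Bond d m → W)).symm.toLinearMap).restrictScalars ℝ)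
          (fun y v => A' * Real.exp (-(r₁ * tdist m (UT.toSite m y) (UT.toSite m v)))) := by
  obtain ⟨α₀, r₁, A, hα₀, hr₁, hA, HK⟩ := exists_bondPoint_decay_Kinv_diagonal_closed hd L hL hL3 φ hMφ hMφ' hφ hφ' hstar ha ha' hϱ0 hϱ1 τ
    hτ hCτ hτm hMτ hρw hτ₁ hτ₂ hφτ
  refine ⟨α₀, r₁, Real.sqrt d * A, hα₀, hr₁, by positivity, ?_⟩
  intro n η hηL c₀ c₁ _ _ hw hρ m _ hm U αU hα0 hα1 hαL hU1 hreg εU hεU hUε hLb α hα hαle hUst hUb hUη hpl hεg hpos hQ η₀ L₀ M₀ R H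
  classical
  -- the restriction family `r_y` to the coarse bonds at `y` exists (no definition minted)
  obtain ⟨rF, hrF⟩ := exists_block_clm_family (𝕜 := ℂ) (w := fun _ : Bond d m => c₁) (V := W) (fun c : Bond d m => bpos c)
  have hdec := HK n η hηL c₀ c₁ hw hρ m hm U αU hα0 hα1 hαL hU1 hreg εU hεU hUε hLb α hα hαle hUst hUb hUη hpl hεg hpos hQ rF hrF
  exact hasMaj_bond_sup_of_pointDecay m (KinvLatticeK hpos hQ) η₀ L₀ M₀ R H hd hrF hA hdec

include hd hL hL3 hMφ hMφ' hφ hφ' hstar ha ha' hϱ0 hϱ1 hτ hCτ hτm hMτ hρw hτ₁ hτ₂ hφτ in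
/-- **THE SAME IN THE GEOMETRY's OWN DISTANCE, OPERATOR AS A CONTINUOUS LINEAR MAP** (`δ_I = r₁∕d`): token for token the `hInv₀` binder of
`Beta.RemainderOriginTwoLetters.ineq190_origin_of_two_letters` on NE9's tower, `∃ (α₀, r₁, A′)` before the height, the volume and the background —
a tree theorem BY NAME ((FCLK)), no displayed analytic letter.
[cite: Balaban1985BackgroundPropagators, (3.126) p.420, (3.129) p.421, (3.132) p.422, (3.35)–(3.37) p.396] [cite: Balaban1985Variational, (129) p.297, (182) p.307, (190) p.308]
[cite: Balaban1984PropagatorsII, (2.51)–(2.52) p.232, (2.54) p.233] -/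
theorem exists_hasMaj_Kinv_tower :
    ∃ α₀ r₁ A' : ℝ, 0 < α₀ ∧ 0 < r₁ ∧ 0 ≤ A' ∧
      ∀ (n : ℕ) (η : ℝ) (_hηL : η * (L : ℝ) ^ (n + 1) = 1) (c₀ c₁ : ℝ) [Fact (0 < c₀)] [Fact (0 < c₁)]
        (_hw : c₀ * ((L : ℝ) ^ (n + 1)) ^ d = c₁) (_hρ : |η| ^ d / c₀ ≤ ρw) (m : Fin d → ℕ) [∀ i, NeZero (m i)] (_hm : ∀ i, 1 ≤ m i)
        (U : Bond d (towerP L m (n + 1)) → 𝔸ˣ) (αU : ℕ → ℝ) (_hα0 : ∀ j, 0 ≤ αU j) (hα1 : ∀ j, αU j ≤ 1 / 64)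
        (hαL : ∀ j, 50 * (d + 1) * αU j * (L : ℝ) ^ d ≤ 1 / 2)
        (hU1 : ∀ (j : ℕ) (x : B7Prop1Explicit.Site d) (k : Fin d), perCfg (towerP L m (j + 1)) (UlevOf L m (n + 1) U j) x k ∈ U1 𝔸)
        (hreg : ∀ (j : ℕ) (y : TSite d (towerP L m j)) (k : Fin d) (ρ' : Fin d → Fin L),
          ‖((Wcx L (perCfg (towerP L m (j + 1)) (UlevOf L m (n + 1) U j)) (cornerSite L y) k (boxVec L ρ') : 𝔸ˣ) : 𝔸) - 1‖ ≤ αU j)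
        (εU : ℕ → ℝ) (_hεU : ∀ j, 0 ≤ εU j) (_hUε : ∀ (j : ℕ) (b : Bond d (towerP L m (j + 1))), ‖(UlevOf L m (n + 1) U j b : 𝔸) - 1‖ ≤ εU j)
        (_hLb : ∀ (j : ℕ) (b : Bond d (towerP L m (j + 1))), UlevOf L m (n + 1) U j b ∈ U1 𝔸)
        (α : ℝ) (_hα : 0 ≤ α) (_hαle : α ≤ α₀)
        (_hUst : ∀ b, star (U b : 𝔸) = (((U b)⁻¹ : 𝔸ˣ) : 𝔸)) (_hUb : ∀ b, U b ∈ U1 𝔸) (_hUη : ∀ b, ‖(U b : 𝔸) - 1‖ ≤ α * η)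
        (_hpl : ∀ p : B9SectCLatticeCarrier.Plaq d (towerP L m (n + 1)), ‖(plaqHolU U p : 𝔸) - 1‖ ≤ α * η ^ 2)
        (_hεg : ∀ j < n + 1, εU j ≤ α * ϱ ^ j)
        (hpos : ∀ x : BondL2K ℂ d (towerP L m (n + 1)) c₀ W, x ≠ 0 →
          0 < RCLike.re ⟪x, laplaceAk L m n φ η U hL αU hα1 hU1 hreg τ (c₀ := c₀) (c₁ := c₁) a x⟫_ℂ)
        (hQ : Function.Surjective (QkW L m n φ U hL αU hα1 hU1 hreg (c₀ := c₀) (c₁ := c₁)))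
        (η₀ L₀ M₀ R : ℝ) (H : Prop),
        HasMaj
          (supSize (toB6 (torusGeom m η₀ L₀ M₀) R H)
            (fun y => Finset.univ.filter fun b : Bond d m => bpos b = UT.toSite m y)
            (fun b => UT.ofSite m (bpos b)) : BlockNorm (toB6 (torusGeom m η₀ L₀ M₀) R H) (Bond d m → W))
          (supSize (toB6 (torusGeom m η₀ L₀ M₀) R H)
            (fun y => Finset.univ.filter fun b : Bond d m => bpos b = UT.toSite m y)
            (fun b => UT.ofSite m (bpos b)))
          (((LinearMap.toContinuousLinearMap
              ((WL2.linearEquiv ℂ ℂ (fun _ : Bond d m => c₁) : BondL2K ℂ d m c₁ W ≃ₗ[ℂ] (Bond d m → W)).toLinearMap ∘ₗ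
                KinvLatticeK hpos hQ ∘ₗ
                (WL2.linearEquiv ℂ ℂ (fun _ : Bond d m => c₁) : BondL2K ℂ d m c₁ W ≃ₗ[ℂ] (Bond d m → W)).symm.toLinearMap)).restrictScalars ℝ :
              (Bond d m → W) →ₗ[ℝ] (Bond d m → W)))
          (fun y v => A' * Real.exp (-(r₁ / d * (toB6 (torusGeom m η₀ L₀ M₀) R H).dist y v))) := by
  obtain ⟨α₀, r₁, A, hα₀, hr₁, hA, HK⟩ := exists_bondPoint_decay_Kinv_diagonal_closed hd L hL hL3 φ hMφ hMφ' hφ hφ' hstar ha ha' hϱ0 hϱ1 τ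
    hτ hCτ hτm hMτ hρw hτ₁ hτ₂ hφτ
  refine ⟨α₀, r₁, Real.sqrt d * A, hα₀, hr₁, by positivity, ?_⟩
  intro n η hηL c₀ c₁ _ _ hw hρ m _ hm U αU hα0 hα1 hαL hU1 hreg εU hεU hUε hLb α hα hαle hUst hUb hUη hpl hεg hpos hQ η₀ L₀ M₀ R H
  classical
  obtain ⟨rF, hrF⟩ := exists_block_clm_family (𝕜 := ℂ) (w := fun _ : Bond d m => c₁) (V := W) (fun c : Bond d m => bpos c)
  have hdec := HK n η hηL c₀ c₁ hw hρ m hm U αU hα0 hα1 hαL hU1 hreg εU hεU hUε hLb α hα hαle hUst hUb hUη hpl hεg hpos hQ rF hrF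
  exact hasMaj_bond_of_pointDecay m (KinvLatticeK hpos hQ) η₀ L₀ M₀ R H hd hrF hA hr₁.le hdec

end Tower

end Literature.MathematicalPhysics.QuantumFieldTheory.Balaban1983to89.Beta.RemainderHasMajQG1QInvTowerClosed

end
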